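import Summits.HodgeConjecture.HodgeConjecture.Theses.SignSymmetricPowers
import Literature.AlgebraicGeometry.Motives.UniversalHypersurfaceFibre
import Literature.AlgebraicGeometry.Motives.HypersurfaceFormsNonsingular

/-!
# K1-B step `stub_signNonsingularAvoidance` (route `SignSymmetricPowers`, item stmt-HodgeConjecture-19716)

Registered stub of the skeleton line `andre-zariski` v5 (skeleton sha16 `eecddb39fe9d9dd1`):
**nonsingularity is a very general condition on the coefficients** — for every degree `d`
(the stub asks for even `d ≥ 4`) there is ONE polynomial `g₀` in the coefficients `(a_e)_{|e| = d}` of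
a quinary form such that

* `g₀` does not vanish at some `ι`-even homogeneous form of degree `d` (the Fermat form
  `Σ xᵢᵈ`, which has only the monomials `xᵢᵈ`, all with `e₀ + e₁ ∈ {0, d}` even), and
* every homogeneous form `f` of degree `d` with `g₀(coeff f) ≠ 0` is nonsingular
  (`SmoothHypersurface.IsNonsingularForm ℂ f`, the projective Jacobian criterion).

This is what lets the composition `VeryGeneralSignCommutatorsInHg_of` of the line discard the
degenerate corners `f = c·Gᵏ` (`k ≥ 2`, `V₊(G)` smooth), at which the REDUCED scheme
`SmoothHypersurface.hypersurface f = V₊(f)_red ≅ V₊(G)` is smooth projective of dimension `3`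
although `f` is singular — the corners that made the unguarded v3 model stubs false
(cell finding E-P3g19-1, extending littype's E-B3-1).

## Proof

Everything is already in the tree's universal-family files
(`Motives/UniversalHypersurfaceFamily`, `Motives/UniversalHypersurfaceFibre`):
the discriminant `discriminantSet k n d ⊆ Spec R` (`R = k[a_e]`) is closed
(`isClosed_discriminantSet`, properness of `ℙⁿ⁺¹_R → Spec R`), hence a zero locus `Z(I)`;
the point `[Φ]` of the Fermat form lies in `U = Spec R ∖ Z(I)`
(`specMap_coeffHom_apply_mem_baseOpens` with `isNonsingularForm_sum_X_pow`), so some `g₀ ∈ I`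
is not in the kernel of `a_e ↦ coeff_e Φ`, i.e. `g₀(coeff Φ) ≠ 0`; and if `g₀(coeff f) ≠ 0` then
`[f] ∉ Z(I)`, so `[f]` lifts to a `k`-point `s` of `U` with `pointForm s = f`
(`IsOpenImmersion.lift`, `map_coeffHom_universalForm`), whence `f` is nonsingular by
`isNonsingularForm_pointForm`. [folklore; cite: VoisinHodgeII2003, §6.2.1; Hartshorne1977, I Ex. 5.8]
-/

noncomputable section

namespace Summit.HodgeConjecture.HodgeConjecture.Theorems.SignSymmetricPowersNonsingularAvoidance

open CategoryTheory AlgebraicGeometry MvPolynomial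
open Literature.AlgebraicGeometry.Motives
open Literature.AlgebraicGeometry.Motives.UniversalHypersurface

universe u

variable {k : Type u} [Field k] {n d : ℕ}

/-- The point `[G] ∈ Spec R` (image of `Spec k` under `a_e ↦ coeff_e G`): a coefficient polynomial
`g` lies in its prime iff `g(coeff G) = 0`. [folklore] -/
theorem mem_asIdeal_specMap_coeffHom_iff (G : MvPolynomial (Fin (n + 2)) k) (y : Spec (.of k))
    (g : CoeffRing k n d) :
    g ∈ ((Spec.map (CommRingCat.ofHom (coeffHom k n d G).toRingHom)).base y).asIdeal ↔
      MvPolynomial.eval (fun m : DegIndex n d => coeff m.1 G) g = 0 := by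
  rw [Spec.map_base]
  change MvPolynomial.eval (fun m : DegIndex n d => coeff m.1 G) g ∈ y.asIdeal ↔ _
  rw [Ideal.eq_bot_of_prime y.asIdeal, Ideal.mem_bot]

/-- **Nonsingularity is very general, with an explicit avoidance polynomial**: given one
nonsingular form `Φ` of degree `d`, there is a coefficient polynomial `g₀` with `g₀(coeff Φ) ≠ 0`
such that every degree-`d` form `G` with `g₀(coeff G) ≠ 0` is nonsingular (`g₀` = an element of
the ideal of the closed discriminant not vanishing at `[Φ]`). [folklore; cite: VoisinHodgeII2003, §6.2.1] -/
theorem exists_avoidance_polynomial (k : Type u) [Field k] (n d : ℕ)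
    {Φ : MvPolynomial (Fin (n + 2)) k} (hΦ : Φ.IsHomogeneous d)
    (hJΦ : SmoothHypersurface.IsNonsingularForm k Φ) :
    ∃ g₀ : CoeffRing k n d,
      MvPolynomial.eval (fun m : DegIndex n d => coeff m.1 Φ) g₀ ≠ 0 ∧
      ∀ G : MvPolynomial (Fin (n + 2)) k, G.IsHomogeneous d →
        MvPolynomial.eval (fun m : DegIndex n d => coeff m.1 G) g₀ ≠ 0 →
          SmoothHypersurface.IsNonsingularForm k G := by
  classical
  -- the discriminant is a closed subset `Z(I)` of `Spec R`
  obtain ⟨I, hI⟩ :=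
    (PrimeSpectrum.isClosed_iff_zeroLocus_ideal _).mp (isClosed_discriminantSet k n d)
  -- the point `[Φ]` is not in it
  let y₀ : Spec (.of k) := IsLocalRing.closedPoint k
  have hΦU : (Spec.map (CommRingCat.ofHom (coeffHom k n d Φ).toRingHom)).base y₀ ∉
      discriminantSet k n d :=
    (mem_baseOpens_iff k n d _).mp (specMap_coeffHom_apply_mem_baseOpens k n d hΦ hJΦ y₀)
  rw [hI] at hΦU
  obtain ⟨g₀, hg₀I, hg₀Φ⟩ : ∃ g₀ ∈ I,
      g₀ ∉ ((Spec.map (CommRingCat.ofHom (coeffHom k n d Φ).toRingHom)).base y₀).asIdeal := by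
    by_contra! h
    exact hΦU h
  refine ⟨g₀, fun h => hg₀Φ ((mem_asIdeal_specMap_coeffHom_iff Φ y₀ g₀).mpr h), fun G hG hGg => ?_⟩
  -- every point `[G]` with `g₀(coeff G) ≠ 0` lies in `U`
  have hGU : ∀ y : Spec (.of k),
      (Spec.map (CommRingCat.ofHom (coeffHom k n d G).toRingHom)).base y ∈ baseOpens k n d := by
    intro y
    rw [mem_baseOpens_iff, hI]
    intro hmem
    exact hGg ((mem_asIdeal_specMap_coeffHom_iff G y g₀).mp (hmem hg₀I))
  -- so `[G]` lifts to a `k`-point `s` of `U` with `pointForm s = G`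
  let P : Spec (.of k) ⟶ (baseOpens k n d).toScheme :=
    IsOpenImmersion.lift (baseOpens k n d).ι
      (Spec.map (CommRingCat.ofHom (coeffHom k n d G).toRingHom))
      (by
        rintro _ ⟨y, rfl⟩
        rw [Scheme.Opens.range_ι]
        exact hGU y)
  have hP : P ≫ (baseOpens k n d).ι = Spec.map (CommRingCat.ofHom (coeffHom k n d G).toRingHom) :=
    IsOpenImmersion.lift_fac _ _ _
  let s : AlgPoints (base k n d) k :=
    AlgPoints.mk (X := base k n d) P
      (by
        have hc : (coeffHom k n d G).toRingHom.comp (algebraMap k (CoeffRing k n d)) =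
            algebraMap k k :=
          RingHom.ext fun r => (coeffHom k n d G).commutes r
        change (P ≫ (baseOpens k n d).ι) ≫ specCoeffToSpec k n d = _
        rw [hP, ← Spec.map_comp, ← CommRingCat.ofHom_comp, hc])
  have hhom : pointHom k n d s = CommRingCat.ofHom (coeffHom k n d G).toRingHom := by
    apply Spec.map_injective
    rw [Spec_map_pointHom]
    exact hP
  have hsG : pointForm k n d s = G := by
    rw [pointForm, hhom, CommRingCat.hom_ofHom]
    exact map_coeffHom_universalForm k n d G hG
  simpa only [hsG] using isNonsingularForm_pointForm k n d s

/-- The Fermat form `Σᵢ xᵢᵈ` has only the coefficients `e = d·δᵢ`; in particular it is `ι`-even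
(`coeff_e = 0` unless `e₀ + e₁` is even) when `d` is even. [folklore] -/
theorem coeff_sum_X_pow_eq_zero_of_not_even {d : ℕ} (hd : Even d) (e : Fin 5 →₀ ℕ)
    (he : ¬ Even (e 0 + e 1)) :
    (∑ i : Fin 5, (X i : MvPolynomial (Fin 5) ℂ) ^ d).coeff e = 0 := by
  classical
  rw [coeff_sum]
  refine Finset.sum_eq_zero fun i _ => ?_
  rw [coeff_X_pow, if_neg]
  rintro rfl
  apply he
  simp only [Finsupp.single_apply]
  split_ifs <;> simp [hd]

/-- **`stub_signNonsingularAvoidance`** (registered stub of line `andre-zariski` v5 on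
stmt-HodgeConjecture-19716): for even `d ≥ 4` one coefficient polynomial `g₀` which is nonzero at an
`ι`-even homogeneous form of degree `d` (the Fermat quintic-space form `Σ xᵢᵈ`) and whose
non-vanishing at a homogeneous `f` of degree `d` forces `f` to be nonsingular. [folklore] -/
theorem stub_signNonsingularAvoidance :
    open Literature.AlgebraicGeometry.Motives Literature.AlgebraicGeometry.HodgeTheory Literature.AlgebraicGeometry.HodgeTheory.BettiUniverse CategoryTheory.Limits in ∀ ⦃d : ℕ⦄, Even d → 4 ≤ d → ∃ g₀ : MvPolynomial {e : Fin 5 →₀ ℕ // e.degree = d} ℂ, (∃ f : MvPolynomial (Fin 5) ℂ, f.IsHomogeneous d ∧ (∀ e : Fin 5 →₀ ℕ, ¬ Even (e 0 + e 1) → f.coeff e = 0) ∧ MvPolynomial.eval (fun e : {e : Fin 5 →₀ ℕ // e.degree = d} => f.coeff e.1) g₀ ≠ 0) ∧ ∀ f : MvPolynomial (Fin 5) ℂ, f.IsHomogeneous d → MvPolynomial.eval (fun e : {e : Fin 5 →₀ ℕ // e.degree = d} => f.coeff e.1) g₀ ≠ 0 → SmoothHypersurface.IsNonsingularForm ℂ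 f := by
  intro d hd h4
  have hdC : ((d : ℕ) : ℂ) ≠ 0 := by exact_mod_cast (show d ≠ 0 by omega)
  have hΦhom : (∑ i : Fin 5, (X i : MvPolynomial (Fin 5) ℂ) ^ d).IsHomogeneous d :=
    IsHomogeneous.sum _ _ _ fun i _ => by simpa using (isHomogeneous_X ℂ i).pow d
  have hΦJ : SmoothHypersurface.IsNonsingularForm ℂ (∑ i : Fin 5, (X i : MvPolynomial (Fin 5) ℂ) ^ d) :=
    SmoothHypersurface.isNonsingularForm_sum_X_pow (n := 3) hdC
  obtain ⟨g₀, hg₀Φ, hg₀⟩ := exists_avoidance_polynomial ℂ 3 d hΦhom hΦJ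
  exact ⟨g₀, ⟨_, hΦhom, fun e he => coeff_sum_X_pow_eq_zero_of_not_even hd e he, hg₀Φ⟩,
    fun f hf hfg => hg₀ f hf hfg⟩

end Summit.HodgeConjecture.HodgeConjecture.Theorems.SignSymmetricPowersNonsingularAvoidance
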